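import Literature.MathematicalPhysics.QuantumFieldTheory.Balaban1983to89.B11Eq73KernelConcrete
import Literature.MathematicalPhysics.QuantumFieldTheory.Balaban1983to89.B7Eq136ThirdPolarization

/-!
# `Balaban1983to89.B11Rem289KernelConcrete` — T. Bałaban, *The variational problem and background fields in renormalization group method
for lattice gauge theories*, Commun. Math. Phys. **102** (1985) 277–309 [Balaban1985Variational], the remark after Proposition 3, p. 289:
**«The operator 𝔇(A′) is an analytic function in A′, and its expansion begins with a linear term in A′, coming from the differentiation of
D^{(2)}(A′) = C^{(2)}(A′). If we subtract these terms from 𝔇(A′), then we get an operator 𝔇₂(A′) for which we have the bound (73) with ε₃²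
instead of ε₃»** — AT KERNEL LEVEL, WITH THE EXPONENTIAL DECAY OF (73), FOR THE CONCRETE FIXED POINT `D̃` OF (49) (the remainder `C_j(U₀, ·)`
of [4] on the `ℤᵈ` carrier): `‖𝔇₂(A′; c, b)X‖ ≤ K·ε²·L^{−jd}·e^{−½δ₀d(c₋, b)}·‖X‖` with an explicit `(d, L)`-constant `K`, DERIVED from (68),
the kernel bound (69) of `ℜ`, (73), the size (55) of `HD̃(A′)` and the (149)-type bound on the second polarization of `C_j` away from the
origin (Schwarz lemma in the radial variable) — not read off (73) by a Schwarz-lemma step (cf. `B11SchwarzRemainder.reading_frakD2` /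
`tightness_witness`: that route gives `ε₃²` only with the chart radius in the constant; here the constant carries `b⁻¹`, `C₂B₀`, `B₁c₁` instead)

statement-level skeleton of published theorems with citation tags; proofs where landed; nothing here is a claim about the Yang–Mills mass gap

PDF held: `paper:balaban1985-cmp102-variational-background` (journal page = PDF page + 276); p. 289 [PDF 13], render
`run/shared/lean/pub/pub-balaban/b2b-balaban-ref1/pages/1985-cmp102-variational-background/…-p013-x2.png` read as image by this seat
(2026-08-21); [3] = [Balaban1984PropagatorsII] Lemma 2.1; [4] = [Balaban1985Averaging] (136)–(138) p. 39, (141), (149) p. 40, (157) p. 42;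
[5] = [Balaban1985BackgroundPropagators] Thm 3.12.

CITATION HEADER / WHAT IS REPRODUCED.  Cell `lit-balaban`, Phase-2 proof seat p06 gen 7 = unit `lit-balaban-p06` (TAKING line HOME/STATUS.md
2026-08-21, gen 7, #3); SKELETON row **B11.Rem@289** (owner r08: `B11SchwarzRemainder.reading_frakD2` = the one-variable Schwarz-lemma READING
of the remark, with `tightness_witness`; p06 g6 `B11Rem289Concrete.norm_frakD2_apply_le` = the remark for the concrete `D̃` in OPERATOR form,
`‖𝔇(A′)h − 2C⁽²⁾(A′, h)‖ ≤ 8K′‖A′‖²‖h‖`, no decay); cell GAPS row G-adv9-52 (pub-balaban: «the stated bound holds, but not by the argument the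
text suggests at the radius it names») names a kernel-level derivation as «what would certify» — this file is one, on the concrete carrier.
Consumers in print: (85)–(86) p. 291 («the ⟨HD₃, J⟩-term via (73)»), [B13] (1.39).  THE PRINT (p. 289): (73) *«|𝔇(A′; c, b)| ≦ O(1)C₃ε₃
(Lʲη)^{−d+1}e^{−(1/2)δ₀d(c₋,y)}, b ∈ Bʲ(y), y ∈ Λ_j»* and the remark quoted in the title.

DICTIONARY (as `B11Eq71KernelConcrete` / `B11Eq73KernelConcrete`: ONE scale `j`, tree units, sup norms on `𝔸^S ∋ A′`, `𝔸^T ∋ D̃(A′)`; coarse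
bonds `c = (z, κ) ∈ T`, `c₋ = Lʲz`; fine bonds `b = (y, μ) ∈ S`).  `𝔇(A′)h = fderiv ℂ D̃ A′ h`; the subtracted linear term `2C⁽²⁾(A′, h)` =
`(2 : ℂ) • C2map A′ h` (`B11Eq44Concrete.C2map` = ½D²[C_j(U₀, ins_S ·)(c)](0), so `2C⁽²⁾(A′, h)(c) = D²f_c(0)(A′, h)`, `f_c := C_j(U₀, ins_S ·)(c)`);
**`𝔇₂(A′; c, b)X := (𝔇(A′)(X·e_b))(c) − 2C⁽²⁾(A′, X·e_b)(c)`**.  `X₀ := A′ − HD̃(A′)` ((57): `‖X₀‖ ≤ 2ε`), `𝒞′ = fderiv ℂ Cmap X₀`, `ℜ = 𝒞′H`,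
`θ = C₃(Lʲ)²·2ε·2d·B₁·e^{2dδ₀}`, `c₁ = d·c₀(δ₀, ½)ᵈ`, `q = θc₁`, `M := (1 − q)⁻¹e^{dδ₀}C₃(Lʲ)²·2ε·L^{−jd}‖X‖` (the constant of (73),
`B11Eq73KernelConcrete.ineq73_kernel_of_eq68`), weight `wt_b(c) = e^{−½δ₀·l1(Lʲz − b₋)/Lʲ}`, locality weight `kerQdd(c, b) = L^{−jd}·[b ⊂ Bʲ(c₋) ∪
Bʲ(c₊)]` ([4] (141)).  Regime: that of `B11Eq72Concrete` (regular background, witness radius `b`), `9C₂(Lʲ)²B₀ε < 1`, **`4ε ≤ b`** (print's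
«2ε₃ ≦ c₄»: the segment from `A′` to `X₀` and the radial Schwarz step live in the half polydisc `‖·‖ ≤ b/2`), (46) `‖HX‖ ≤ B₀‖X‖`, the kernel
decay of `H` `hHker` ([5] Thm 3.12, HYPOTHESIS), `q < 1`.

THE ARGUMENT (not printed; three terms).  By (68) (`B11Eq70Concrete.eq68_concrete`) `𝔇h = 𝒞′(X₀)h − ℜ(𝔇h)`, so
`𝔇₂(A′)h = [𝒞′(X₀)h − 𝒞′(A′)h] + [𝒞′(A′)h − D²f(0)(A′, h)] − ℜ(𝔇h)`.  (T1) the mean-value inequality for `u ↦ Df_c(u)h` on the ball `‖u‖ ≤ b/2`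
with the (149)-type bound `‖D²f_c(u)(Q, R)‖ ≤ 2C₃(Lʲ)²‖Q‖Σ_s kerQdd(c, s)‖R_s‖` (`B7Eq136ThirdPolarization.norm_snd_fderiv_CCovIter_ins_le_at`) and
`‖X₀ − A′‖ = ‖HD̃(A′)‖ ≤ B₀·4C₂(Lʲ)²ε²` ((46), (55)): `≤ 8C₂C₃(Lʲ)⁴B₀ε²·kerQdd(c, b)‖X‖`.  (T2) `D²f_c(u) − D²f_c(0)` in pairing form is
`≤ 8C₃(Lʲ)²b⁻¹‖u‖·‖Q‖Σ…` for `‖u‖ < b/2` (Schwarz lemma for `τ ↦ D²f_c(τu)(Q, R)` on the disc `|τ| < b/(2‖u‖)`, Mathlib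
`Complex.dist_le_div_mul_dist_of_mapsTo_ball`), whence by the mean-value inequality from `0` (`Df_c(0) = 0`, [4] (134)–(136)) `‖Df_c(A′)h −
D²f_c(0)(A′, h)‖ ≤ 8C₃(Lʲ)²b⁻¹‖A′‖²Σ_s kerQdd(c, s)‖h_s‖`.  (T3) `‖(ℜ𝔇h)(c)‖ ≤ θΣ_{c″}e^{−δ₀l1(z − z″)}‖(𝔇h)(c″)‖` ((69) at kernel level,
`B11Eq71KernelConcrete.ineq69_kernel`) fed with the (73)-profile `‖(𝔇(X·e_b))(c″)‖ ≤ M·wt_b(c″)` and Lemma 2.1 [3] (`profile_contraction`,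
`rowSum_T`): `≤ θc₁M·wt_b(c) = q·M·wt_b(c)` — quadratic in `ε` because `θ ∝ ε` and `M ∝ ε`.

WHAT THIS FILE PROVES (theorems only; kernel, 0 sorry, standard axioms).
* §1 (pairing-form bounds for `f_c = C_j(U₀, ins_S ·)(c)` away from `0`; `j ≤ k`): **`norm_fderiv2_sub_fderiv2_zero_le`** (T2's Schwarz step),
  **`norm_fderiv_sub_fderiv_le`** (T1: `‖Df_c(Y)R − Df_c(Y′)R‖ ≤ 2C₃(Lʲ)²(Σ_s kerQdd‖R_s‖)‖Y − Y′‖` on `‖Y‖, ‖Y′‖ ≤ b/2`),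
  **`norm_fderiv_sub_fderiv2_zero_le`** (T2: `‖Df_c(A′)R − D²f_c(0)(A′, R)‖ ≤ 8C₃(Lʲ)²b⁻¹‖A′‖²Σ_s kerQdd‖R_s‖`, `‖A′‖ < b/2`), `sum_kerQdd_single`.
* §2 **`frakD2_kernel_concrete`**: for every `‖A′‖ < ε`, fine bond `b`, `X ∈ 𝔸`, coarse bond `c`:
  `‖𝔇₂(A′; c, b)X‖ ≤ [8C₂C₃(Lʲ)⁴B₀ + 8C₃(Lʲ)²b⁻¹]·ε²·kerQdd(c, b)·‖X‖ + q·M·wt_b(c)` (the three terms), and **`frakD2_kernel_concrete_decay`**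
  (`q ≤ ½`): `‖𝔇₂(A′; c, b)X‖ ≤ K·ε²·L^{−jd}·e^{−½δ₀·l1(Lʲz − b₋)/Lʲ}·‖X‖`, `K = 8e^{dδ₀}C₃(Lʲ)²(C₂(Lʲ)²B₀ + b⁻¹) + 16d·B₁c₁e^{3dδ₀}(C₃(Lʲ)²)²` —
  «the bound (73) with ε₃² instead of ε₃», the `O(1)` a `(d, L)`-constant (through `b⁻¹`, `C₂B₀`, `B₁c₁`), in agreement with the cell's reading
  of the remark (G-adv9-52, `B11SchwarzRemainder`).
NOT CLAIMED: the kernel bound of `H` ([5] Thm 3.12 — hypothesis `hHker`); a radius-free `O(1)`; the multi-scale version; (85)–(86).  NOT summit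
progress.
v1.1 (p06 gen 7): v1 kept byte-identical; + 1 `open` + §3 `frakD2_Dfix_decay` (the same bound for r08's selector `B11Prop3Model.Dfix`).
-/

noncomputable section

open scoped BigOperators Topology
open NormedSpace Finset Metric Filter Set

namespace Literature.MathematicalPhysics.QuantumFieldTheory.Balaban1983to89.B11Rem289KernelConcrete

open B7Prop1Explicit B7Prop1Local B7Prop2Explicit B7Prop3Flat B7Prop4Flat B7Eq92Concrete B7Prop3GeneralLinear
  B7Prop4GeneralLevels B7Prop5GeneralOperators B7Prop5GeneralInduction B7Prop5GeneralLevels B7Prop5General B7Ineq149Pairing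
  B13Contraction113 B11Eq44Concrete B12SecondOrder267Concrete B11Eq70Concrete B11Eq72Concrete B7Eq136SecondOrder B7Eq136ThirdPolarization
open B7Prop5Flat (BondIn)
open B11Eq71KernelConcrete B11Eq73KernelConcrete
open B11Prop3Model (Dfix Dfix_ball Dfix_fix)

-- `Site` alone would resolve to the torus sites of `Setup.lean`; re-export the `ℤ^d` sites of `B7Prop1Explicit`.
export B7Prop1Explicit (Site)

variable {d : ℕ}

section Regime

variable {𝔸 : Type*} [NormedRing 𝔸] [NormedAlgebra ℂ 𝔸] [CompleteSpace 𝔸] [NormOneClass 𝔸]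

variable (L : ℕ) (hL : 2 ≤ L) {G : Subgroup 𝔸ˣ} (hG : AvgClosed d L G) (k : ℕ)
  (U₀ : Site d → Fin d → 𝔸ˣ) (hU₀ : ∀ x κ, U₀ x κ ∈ G) {α₀ : ℝ} (hα : 0 < α₀)
  (hα3 : C0 d * α₀ ≤ 1 / 3) (hα4 : 4 * α₀ ≤ c2' d L) (h52 : pdev U₀ < α₀ * (((L : ℝ) ^ k)⁻¹) ^ 2)
  {b : ℝ} (hb : 0 < b)
  (hsmall : Real.exp (4 * (800 * ((d : ℝ) + 1) ^ 2 * ((d : ℝ) + 4)) * α₀)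
    * (1 + 8 * (131072 * ((d : ℝ) + 1) ^ 2) * ((L : ℝ) ^ k * b)) ≤ 2)
  (hc₃ : 4 * ((L : ℝ) ^ k * b) < c3 d L)
  (h145 : 8 * d * thetaGen d L α₀ * (L : ℝ)⁻¹ ^ 4 ≤ 1)
  (h155 : (2 * (L : ℝ) - 1) * (L : ℝ)⁻¹ ^ 2 + 2 * d * thetaGen d L α₀ * (L : ℝ)⁻¹ ^ 3
    + 1 / 8 * (1 + 2 * d * thetaGen d L α₀ * (L : ℝ)⁻¹ ^ 2 + 2 * d * C3Gen d L * ((L : ℝ) ^ k * b)) * (L : ℝ)⁻¹ ^ 2 ≤ 1)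
  (S T : Finset (Site d × Fin d)) (H : (T → 𝔸) →L[ℂ] (S → 𝔸)) {B₀ B₁ δ₀ ε : ℝ}

/-! ## §1 Pairing-form bounds for the first and second polarizations of `f_c = C_j(U₀, ins_S ·)(c)` away from the origin -/

omit [NormedAlgebra ℂ 𝔸] [CompleteSpace 𝔸] [NormOneClass 𝔸] in
/-- the pairing weight of a single column: `Σ_s kerQdd(c, s)‖(X·e_b)_s‖ = kerQdd(c, b)‖X‖`. [cite: Balaban1985Averaging, (141) p.39] -/
theorem sum_kerQdd_single (j : ℕ) (z : Site d) (κ : Fin d) (bnd : S) (X : 𝔸) :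
    ∑ s : S, kerQdd L j z κ s.1.1 s.1.2 * ‖(Pi.single bnd X : S → 𝔸) s‖ = kerQdd L j z κ bnd.1.1 bnd.1.2 * ‖X‖ := by
  classical
  rw [Finset.sum_eq_single bnd]
  · rw [Pi.single_eq_same]
  · intro s _ hs
    rw [Pi.single_eq_of_ne hs, norm_zero, mul_zero]
  · intro h
    exact absurd (Finset.mem_univ bnd) h

include hL hG hU₀ hα hα3 hα4 h52 hb hsmall hc₃ h145 h155 in
/-- **THE SECOND POLARIZATION IS LIPSCHITZ AT THE ORIGIN IN PAIRING FORM** (the Schwarz step of (T2)): for `‖u‖ < b/2` and all `Q, R ∈ 𝔸^S`,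
`‖D²f_c(u)(Q, R) − D²f_c(0)(Q, R)‖ ≤ 8C₃(Lʲ)²b⁻¹‖u‖·‖Q‖·Σ_s kerQdd(c, s)‖R_s‖` — the function `τ ↦ D²f_c(τu)(Q, R)` is analytic on the disc
`|τ| < b/(2‖u‖) ∋ 1` and bounded there by `2C₃(Lʲ)²‖Q‖Σ…` (`norm_snd_fderiv_CCovIter_ins_le_at`, [4] (149) twice), so the Schwarz lemma bounds its
increment from `0` to `1` by `2·(bound)/(radius)`. [cite: Balaban1985Averaging, (149) p.40, (136)–(137) p.39] [cite: Balaban1985Variational, p.289 (remark after Prop. 3)] -/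
theorem norm_fderiv2_sub_fderiv2_zero_le {j : ℕ} (hj : j ≤ k) (z : Site d) (κ : Fin d) {u : S → 𝔸} (hu : ‖u‖ < b / 2)
    (Q R : S → 𝔸) :
    ‖fderiv ℂ (fderiv ℂ (fun a' : S → 𝔸 => CCovIter L U₀ (insCfg S a') j z κ)) u Q R -
        fderiv ℂ (fderiv ℂ (fun a' : S → 𝔸 => CCovIter L U₀ (insCfg S a') j z κ)) 0 Q R‖ ≤
      8 * (C3Gen d L * ((L : ℝ) ^ j) ^ 2) * b⁻¹ * ‖u‖ * ‖Q‖ * ∑ s : S, kerQdd L j z κ s.1.1 s.1.2 * ‖R s‖ := by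
  set f := fun a' : S → 𝔸 => CCovIter L U₀ (insCfg S a') j z κ with hf
  set Ssum : ℝ := ∑ s : S, kerQdd L j z κ s.1.1 s.1.2 * ‖R s‖ with hSsum
  have hSsum0 : 0 ≤ Ssum := sum_nonneg fun s _ => mul_nonneg (kerQdd_nonneg L j z κ _ _) (norm_nonneg _)
  have hC : 0 ≤ C3Gen d L := by unfold C3Gen C1ppGen; positivity
  set M₀ : ℝ := 2 * (C3Gen d L * ((L : ℝ) ^ j) ^ 2) * ‖Q‖ * Ssum with hM₀
  have hM₀0 : 0 ≤ M₀ := by positivity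
  by_cases hu0 : u = 0
  · subst hu0
    simp
  have hupos : 0 < ‖u‖ := norm_pos_iff.mpr hu0
  set ρ : ℝ := b / 2 / ‖u‖ with hρ
  have hρ1 : 1 < ρ := by rw [hρ, lt_div_iff₀ hupos, one_mul]; exact hu
  have hρpos : 0 < ρ := one_pos.trans hρ1
  -- the points `τ•u`, `|τ| < ρ`, lie in the half polydisc
  have hpt : ∀ τ : ℂ, ‖τ‖ < ρ → ∀ s, ‖(τ • u) s‖ ≤ b / 2 := by
    intro τ hτ s
    calc ‖(τ • u) s‖ = ‖τ‖ * ‖u s‖ := by rw [Pi.smul_apply, norm_smul]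
      _ ≤ ‖τ‖ * ‖u‖ := mul_le_mul_of_nonneg_left (norm_le_pi_norm u s) (norm_nonneg _)
      _ ≤ ρ * ‖u‖ := mul_le_mul_of_nonneg_right hτ.le (norm_nonneg _)
      _ = b / 2 := by rw [hρ, div_mul_cancel₀ _ hupos.ne']
  set g : ℂ → 𝔸 := fun τ => fderiv ℂ (fderiv ℂ f) (τ • u) Q R with hg
  -- `g` is differentiable on the disc
  have hdiff : DifferentiableOn ℂ g (ball (0 : ℂ) ρ) := by
    intro τ hτ
    rw [mem_ball_zero_iff] at hτ
    have han : AnalyticAt ℂ f (τ • u) :=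
      analyticAt_CCovIter_ins L hL hG k U₀ hU₀ hα hα3 hα4 h52 hb hsmall hc₃ S hj z κ
        (fun s => (hpt τ hτ s).trans (by linarith))
    have hℓ : DifferentiableAt ℂ (fun τ : ℂ => τ • u) τ := differentiableAt_id.smul_const u
    have h2 : DifferentiableAt ℂ (fun τ : ℂ => fderiv ℂ (fderiv ℂ f) (τ • u)) τ := by
      have h2' := han.fderiv.fderiv.differentiableAt.comp τ hℓ
      simpa [Function.comp_def] using h2'
    exact ((h2.clm_apply (differentiableAt_const Q)).clm_apply (differentiableAt_const R)).differentiableWithinAt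
  -- `g` is bounded by `M₀` on the disc ([4] (149) for the second polarization)
  have hbd : ∀ τ : ℂ, ‖τ‖ < ρ → ‖g τ‖ ≤ M₀ := fun τ hτ =>
    norm_snd_fderiv_CCovIter_ins_le_at L hL hG k U₀ hU₀ hα hα3 hα4 h52 hb hsmall hc₃ h145 h155 S hj z κ (hpt τ hτ) Q R
  have hmaps : MapsTo g (ball (0 : ℂ) ρ) (closedBall (g 0) (2 * M₀)) := by
    intro τ hτ
    rw [mem_ball_zero_iff] at hτ
    rw [mem_closedBall, dist_eq_norm]
    calc ‖g τ - g 0‖ ≤ ‖g τ‖ + ‖g 0‖ := norm_sub_le _ _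
      _ ≤ M₀ + M₀ := add_le_add (hbd τ hτ) (hbd 0 (by simpa using hρpos))
      _ = 2 * M₀ := by ring
  have h1 : (1 : ℂ) ∈ ball (0 : ℂ) ρ := by simpa using hρ1
  -- the Schwarz lemma
  have hschwarz := Complex.dist_le_div_mul_dist_of_mapsTo_ball hdiff hmaps h1
  rw [dist_eq_norm, dist_zero_right, norm_one, mul_one] at hschwarz
  have hg1 : g 1 = fderiv ℂ (fderiv ℂ f) u Q R := by simp [hg]
  have hg0 : g 0 = fderiv ℂ (fderiv ℂ f) 0 Q R := by simp [hg]
  rw [hg1, hg0] at hschwarz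
  refine hschwarz.trans (le_of_eq ?_)
  rw [hρ, hM₀]
  field_simp
  ring

include hL hG hU₀ hα hα3 hα4 h52 hb hsmall hc₃ h145 h155 in
/-- **(T1) THE FIRST POLARIZATION IS LIPSCHITZ IN PAIRING FORM ON THE HALF POLYDISC**: for `‖Y‖, ‖Y′‖ ≤ b/2` and every `R ∈ 𝔸^S`,
`‖Df_c(Y)R − Df_c(Y′)R‖ ≤ 2C₃(Lʲ)²·(Σ_s kerQdd(c, s)‖R_s‖)·‖Y − Y′‖` — the mean-value inequality for `u ↦ Df_c(u)R` on the (convex) ball, whose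
derivative `Q ↦ D²f_c(u)(Q, R)` is bounded by [4] (149) for the second polarization (`norm_snd_fderiv_CCovIter_ins_le_at`).
[cite: Balaban1985Averaging, (149) p.40, (137)–(138) p.39] [cite: Balaban1985Variational, (72) p.289] -/
theorem norm_fderiv_sub_fderiv_le {j : ℕ} (hj : j ≤ k) (z : Site d) (κ : Fin d) {Y Y' : S → 𝔸} (hY : ‖Y‖ ≤ b / 2)
    (hY' : ‖Y'‖ ≤ b / 2) (R : S → 𝔸) :
    ‖fderiv ℂ (fun a' : S → 𝔸 => CCovIter L U₀ (insCfg S a') j z κ) Y R -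
        fderiv ℂ (fun a' : S → 𝔸 => CCovIter L U₀ (insCfg S a') j z κ) Y' R‖ ≤
      2 * (C3Gen d L * ((L : ℝ) ^ j) ^ 2) * (∑ s : S, kerQdd L j z κ s.1.1 s.1.2 * ‖R s‖) * ‖Y - Y'‖ := by
  set f := fun a' : S → 𝔸 => CCovIter L U₀ (insCfg S a') j z κ with hf
  set Ssum : ℝ := ∑ s : S, kerQdd L j z κ s.1.1 s.1.2 * ‖R s‖ with hSsum
  have hSsum0 : 0 ≤ Ssum := sum_nonneg fun s _ => mul_nonneg (kerQdd_nonneg L j z κ _ _) (norm_nonneg _)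
  have hC : 0 ≤ C3Gen d L := by unfold C3Gen C1ppGen; positivity
  -- the map `u ↦ Df(u)R` and its derivative on the closed ball of radius `b/2`
  have hGd : ∀ u ∈ closedBall (0 : S → 𝔸) (b / 2),
      HasFDerivAt (fun u : S → 𝔸 => fderiv ℂ f u R)
        ((ContinuousLinearMap.apply ℂ 𝔸 R).comp (fderiv ℂ (fderiv ℂ f) u)) u := by
    intro u hu
    rw [mem_closedBall_zero_iff] at hu
    have han : AnalyticAt ℂ f u := analyticAt_CCovIter_ins L hL hG k U₀ hU₀ hα hα3 hα4 h52 hb hsmall hc₃ S hj z κ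
      (fun s => (norm_le_pi_norm u s).trans (hu.trans (by linarith)))
    exact (ContinuousLinearMap.apply ℂ 𝔸 R).hasFDerivAt.comp u han.fderiv.differentiableAt.hasFDerivAt
  have hbound : ∀ u ∈ closedBall (0 : S → 𝔸) (b / 2),
      ‖fderiv ℂ (fun u : S → 𝔸 => fderiv ℂ f u R) u‖ ≤ 2 * (C3Gen d L * ((L : ℝ) ^ j) ^ 2) * Ssum := by
    intro u hu
    rw [(hGd u hu).fderiv]
    have hu' : ∀ s, ‖u s‖ ≤ b / 2 := fun s => (norm_le_pi_norm u s).trans (mem_closedBall_zero_iff.1 hu)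
    refine ContinuousLinearMap.opNorm_le_bound _ (by positivity) fun Q => ?_
    have h := norm_snd_fderiv_CCovIter_ins_le_at L hL hG k U₀ hU₀ hα hα3 hα4 h52 hb hsmall hc₃ h145 h155 S hj z κ hu' Q R
    calc ‖((ContinuousLinearMap.apply ℂ 𝔸 R).comp (fderiv ℂ (fderiv ℂ f) u)) Q‖ = ‖fderiv ℂ (fderiv ℂ f) u Q R‖ := rfl
      _ ≤ 2 * (C3Gen d L * ((L : ℝ) ^ j) ^ 2) * ‖Q‖ * Ssum := h
      _ = 2 * (C3Gen d L * ((L : ℝ) ^ j) ^ 2) * Ssum * ‖Q‖ := by ring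
  have h := (convex_closedBall (0 : S → 𝔸) (b / 2)).norm_image_sub_le_of_norm_fderiv_le
    (fun u hu => (hGd u hu).differentiableAt) hbound (mem_closedBall_zero_iff.2 hY') (mem_closedBall_zero_iff.2 hY)
  exact h

include hL hG hU₀ hα hα3 hα4 h52 hb hsmall hc₃ h145 h155 in
/-- **(T2) THE CUBIC REMAINDER OF THE DERIVATIVE IN PAIRING FORM**: for `‖A′‖ < b/2` and every `R ∈ 𝔸^S`,
`‖Df_c(A′)R − D²f_c(0)(A′, R)‖ ≤ 8C₃(Lʲ)²b⁻¹·‖A′‖²·Σ_s kerQdd(c, s)‖R_s‖` — the mean-value inequality from `0` (`Df_c(0) = 0`: (136) has no linear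
term, `B7Eq136SecondOrder.fderiv_CCovIter_ins_zero`) for `u ↦ Df_c(u)R − D²f_c(0)(u, R)`, whose derivative `Q ↦ (D²f_c(u) − D²f_c(0))(Q, R)` is
`≤ 8C₃(Lʲ)²b⁻¹‖u‖Σ…` by `norm_fderiv2_sub_fderiv2_zero_le`. [cite: Balaban1985Averaging, (136)–(137) p.39, (149) p.40]
[cite: Balaban1985Variational, p.289 (remark after Prop. 3)] -/
theorem norm_fderiv_sub_fderiv2_zero_le {j : ℕ} (hj : j ≤ k) (z : Site d) (κ : Fin d) {A' : S → 𝔸} (hA : ‖A'‖ < b / 2)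
    (R : S → 𝔸) :
    ‖fderiv ℂ (fun a' : S → 𝔸 => CCovIter L U₀ (insCfg S a') j z κ) A' R -
        fderiv ℂ (fderiv ℂ (fun a' : S → 𝔸 => CCovIter L U₀ (insCfg S a') j z κ)) 0 A' R‖ ≤
      8 * (C3Gen d L * ((L : ℝ) ^ j) ^ 2) * b⁻¹ * ‖A'‖ ^ 2 * ∑ s : S, kerQdd L j z κ s.1.1 s.1.2 * ‖R s‖ := by
  set f := fun a' : S → 𝔸 => CCovIter L U₀ (insCfg S a') j z κ with hf
  set Ssum : ℝ := ∑ s : S, kerQdd L j z κ s.1.1 s.1.2 * ‖R s‖ with hSsum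
  have hSsum0 : 0 ≤ Ssum := sum_nonneg fun s _ => mul_nonneg (kerQdd_nonneg L j z κ _ _) (norm_nonneg _)
  have hC : 0 ≤ C3Gen d L := by unfold C3Gen C1ppGen; positivity
  set D0 := fderiv ℂ (fderiv ℂ f) 0 with hD0
  -- the linear part `u ↦ D²f(0)(u, R)` is the continuous linear map `(apply R) ∘ D0`
  have hlin : ∀ u : S → 𝔸, HasFDerivAt (fun u : S → 𝔸 => D0 u R) ((ContinuousLinearMap.apply ℂ 𝔸 R).comp D0) u := by
    intro u
    have h := ((ContinuousLinearMap.apply ℂ 𝔸 R).comp D0).hasFDerivAt (x := u)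
    exact h
  have hGd : ∀ u ∈ closedBall (0 : S → 𝔸) ‖A'‖,
      HasFDerivAt (fun u : S → 𝔸 => fderiv ℂ f u R - D0 u R)
        ((ContinuousLinearMap.apply ℂ 𝔸 R).comp (fderiv ℂ (fderiv ℂ f) u) - (ContinuousLinearMap.apply ℂ 𝔸 R).comp D0) u := by
    intro u hu
    rw [mem_closedBall_zero_iff] at hu
    have han : AnalyticAt ℂ f u := analyticAt_CCovIter_ins L hL hG k U₀ hU₀ hα hα3 hα4 h52 hb hsmall hc₃ S hj z κ
      (fun s => (norm_le_pi_norm u s).trans (by linarith))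
    exact ((ContinuousLinearMap.apply ℂ 𝔸 R).hasFDerivAt.comp u han.fderiv.differentiableAt.hasFDerivAt).sub (hlin u)
  have hbound : ∀ u ∈ closedBall (0 : S → 𝔸) ‖A'‖,
      ‖fderiv ℂ (fun u : S → 𝔸 => fderiv ℂ f u R - D0 u R) u‖ ≤
        8 * (C3Gen d L * ((L : ℝ) ^ j) ^ 2) * b⁻¹ * ‖A'‖ * Ssum := by
    intro u hu
    rw [(hGd u hu).fderiv]
    have hu' : ‖u‖ ≤ ‖A'‖ := mem_closedBall_zero_iff.1 hu
    have hu2 : ‖u‖ < b / 2 := lt_of_le_of_lt hu' hA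
    refine ContinuousLinearMap.opNorm_le_bound _ (by positivity) fun Q => ?_
    have h := norm_fderiv2_sub_fderiv2_zero_le L hL hG k U₀ hU₀ hα hα3 hα4 h52 hb hsmall hc₃ h145 h155 S hj z κ hu2 Q R
    calc ‖((ContinuousLinearMap.apply ℂ 𝔸 R).comp (fderiv ℂ (fderiv ℂ f) u) - (ContinuousLinearMap.apply ℂ 𝔸 R).comp D0) Q‖
        = ‖fderiv ℂ (fderiv ℂ f) u Q R - D0 Q R‖ := rfl
      _ ≤ 8 * (C3Gen d L * ((L : ℝ) ^ j) ^ 2) * b⁻¹ * ‖u‖ * ‖Q‖ * Ssum := h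
      _ ≤ 8 * (C3Gen d L * ((L : ℝ) ^ j) ^ 2) * b⁻¹ * ‖A'‖ * ‖Q‖ * Ssum := by gcongr
      _ = 8 * (C3Gen d L * ((L : ℝ) ^ j) ^ 2) * b⁻¹ * ‖A'‖ * Ssum * ‖Q‖ := by ring
  have h := (convex_closedBall (0 : S → 𝔸) ‖A'‖).norm_image_sub_le_of_norm_fderiv_le
    (fun u hu => (hGd u hu).differentiableAt) hbound (mem_closedBall_self (norm_nonneg A'))
    (mem_closedBall_zero_iff.2 le_rfl)
  have hf0 : fderiv ℂ f 0 = 0 := fderiv_CCovIter_ins_zero L hL hG k U₀ hU₀ hα hα3 hα4 h52 hb hsmall hc₃ S hj z κ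
  have hG0 : fderiv ℂ f 0 R - D0 0 R = 0 := by
    rw [hf0, map_zero]
    simp
  rw [hG0] at h
  simp only [sub_zero] at h
  refine h.trans (le_of_eq ?_)
  ring

/-! ## §2 The remark at kernel level: `𝔇₂(A′; c, b)` with `ε²` and the decay of (73) -/

variable {Dt : (S → 𝔸) → (T → 𝔸)}

include hL hG hU₀ hα hα3 hα4 h52 hb hsmall hc₃ h145 h155 in
/-- **THE p. 289 REMARK AT KERNEL LEVEL FOR THE CONCRETE `D̃` — THREE TERMS**: for the concrete `D̃` (any map with the fixed-point characterization
(49) + (55)-ball on `‖A′‖ < ε`), in the regime «9C₂(Lʲ)²B₀ε < 1», `4ε ≤ b`, with (46), the kernel decay `hHker` of `H` and `q = θc₁ < 1`: for every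
`‖A′‖ < ε`, fine bond `b`, `X ∈ 𝔸`, coarse bond `c = (z, κ)`,
`‖(𝔇(A′)(X·e_b))(c) − 2C⁽²⁾(A′, X·e_b)(c)‖ ≤ 2C₃(Lʲ)²·B₀4C₂(Lʲ)²ε²·kerQdd(c, b)‖X‖ + 8C₃(Lʲ)²b⁻¹ε²·kerQdd(c, b)‖X‖ + q·M·e^{−½δ₀·l1(Lʲz − b₋)/Lʲ}`,
`M = (1 − q)⁻¹e^{dδ₀}C₃(Lʲ)²·2ε·L^{−jd}‖X‖` — (T1) + (T2) + (T3) of the module docstring ((68) `B11Eq70Concrete.eq68_concrete`, (69) at kernel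
level `B11Eq71KernelConcrete.ineq69_kernel`, (73) `B11Eq73KernelConcrete.ineq73_kernel_of_eq68`, Lemma 2.1 [3] `rowSum_T`).
[cite: Balaban1985Variational, p.289 (remark after Prop. 3), (68)–(69) p.288, (73) p.289, (55) p.286] [cite: Balaban1985Averaging, (149) p.40, (141) p.39] -/
theorem frakD2_kernel_concrete {j : ℕ} (hj : j ≤ k) (hB₀ : 0 ≤ B₀) (hH : ∀ X, ‖H X‖ ≤ B₀ * ‖X‖)
    (hq9 : 9 * ((8 * (131072 * ((d : ℝ) + 1) ^ 2) * Real.exp (4 * (800 * ((d : ℝ) + 1) ^ 2 * ((d : ℝ) + 4)) * α₀))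
      * ((L : ℝ) ^ j) ^ 2) * B₀ * ε < 1) (hε4 : 4 * ε ≤ b)
    (hDball : ∀ B : S → 𝔸, ‖B‖ < ε → Dt B ∈ closedBall (0 : T → 𝔸)
      (4 * ((8 * (131072 * ((d : ℝ) + 1) ^ 2) * Real.exp (4 * (800 * ((d : ℝ) + 1) ^ 2 * ((d : ℝ) + 4)) * α₀))
        * ((L : ℝ) ^ j) ^ 2) * ε ^ 2))
    (hDfix : ∀ B : S → 𝔸, ‖B‖ < ε → Cmap L U₀ S T j (B - H (Dt B)) = Dt B)
    (hδ₀ : 0 < δ₀) (hB₁ : 0 ≤ B₁)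
    (hHker : ∀ (c'' : T) (Y : 𝔸) (s : S),
      ‖H (Pi.single c'' Y) s‖ ≤ B₁ * Real.exp (-(δ₀ * ((l1 (loK L j c''.1.1 - s.1.1) : ℝ) / (L : ℝ) ^ j))) * ‖Y‖)
    (hq : (C3Gen d L * (((L : ℝ) ^ j) ^ 2 * (2 * ε)) * (2 * d) * B₁ * Real.exp (2 * d * δ₀)) * (d * B6.c0 δ₀ (1 / 2) ^ d) < 1)
    {A' : S → 𝔸} (hA : ‖A'‖ < ε) (bnd : S) (X : 𝔸) (c : T) :
    ‖fderiv ℂ Dt A' (Pi.single bnd X) c - (2 : ℂ) • C2map L U₀ S T j A' (Pi.single bnd X) c‖ ≤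
      2 * (C3Gen d L * ((L : ℝ) ^ j) ^ 2) * (B₀ * (4 * ((8 * (131072 * ((d : ℝ) + 1) ^ 2) * Real.exp (4 * (800 * ((d : ℝ) + 1) ^ 2 * ((d : ℝ) + 4)) * α₀)) * ((L : ℝ) ^ j) ^ 2) * ε ^ 2)) * (kerQdd L j c.1.1 c.1.2 bnd.1.1 bnd.1.2 * ‖X‖) +
      8 * (C3Gen d L * ((L : ℝ) ^ j) ^ 2) * b⁻¹ * ε ^ 2 * (kerQdd L j c.1.1 c.1.2 bnd.1.1 bnd.1.2 * ‖X‖) +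
      (C3Gen d L * (((L : ℝ) ^ j) ^ 2 * (2 * ε)) * (2 * d) * B₁ * Real.exp (2 * d * δ₀)) * (d * B6.c0 δ₀ (1 / 2) ^ d) *
        ((1 - (C3Gen d L * (((L : ℝ) ^ j) ^ 2 * (2 * ε)) * (2 * d) * B₁ * Real.exp (2 * d * δ₀)) * (d * B6.c0 δ₀ (1 / 2) ^ d))⁻¹ * (Real.exp (d * δ₀) * (C3Gen d L * ((L : ℝ) ^ j) ^ 2 * (2 * ε) * (((L : ℝ) ^ j) ^ d)⁻¹) * ‖X‖)) *
        Real.exp (-(1 / 2 * δ₀ * ((l1 (loK L j c.1.1 - bnd.1.1) : ℝ) / (L : ℝ) ^ j))) := by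
  have hL1 : 1 ≤ L := le_trans (by norm_num) hL
  have hε0 : 0 < ε := (norm_nonneg _).trans_lt hA
  have hε3 : 3 * ε < b := by linarith
  have hC3 : 0 ≤ C3Gen d L := by unfold C3Gen C1ppGen; positivity
  have hC2 : (0 : ℝ) ≤ ((8 * (131072 * ((d : ℝ) + 1) ^ 2) * Real.exp (4 * (800 * ((d : ℝ) + 1) ^ 2 * ((d : ℝ) + 4)) * α₀)) * ((L : ℝ) ^ j) ^ 2) := by positivity
  have hq4 : 4 * ((8 * (131072 * ((d : ℝ) + 1) ^ 2) * Real.exp (4 * (800 * ((d : ℝ) + 1) ^ 2 * ((d : ℝ) + 4)) * α₀)) * ((L : ℝ) ^ j) ^ 2) * B₀ * ε ≤ 1 := by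
    have hx : 0 ≤ ((8 * (131072 * ((d : ℝ) + 1) ^ 2) * Real.exp (4 * (800 * ((d : ℝ) + 1) ^ 2 * ((d : ℝ) + 4)) * α₀)) * ((L : ℝ) ^ j) ^ 2) * B₀ * ε := mul_nonneg (mul_nonneg hC2 hB₀) hε0.le
    nlinarith
  -- `X₀ = A′ − HD̃(A′)`, `‖X₀‖ ≤ 2ε` ((57))
  have hX₀ := norm_X₀_le L S T H hB₀ hH hε0 hq4 hA (hDball A' hA)
  have hX₀s : ∀ s, ‖(A' - H (Dt A')) s‖ ≤ b := fun s => (norm_le_pi_norm _ s).trans (hX₀.trans (by linarith))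
  -- (68): the column `b` of `𝔇`
  have h68 := eq68_concrete L hL hG k U₀ hU₀ hα hα3 hα4 h52 hb hsmall hc₃ S T H hj hB₀ hH hq9 hε3 hDball hDfix hA
  have hv : fderiv ℂ Dt A' (Pi.single bnd X) + fderiv ℂ (Cmap L U₀ S T j) (A' - H (Dt A')) (H (fderiv ℂ Dt A' (Pi.single bnd X))) =
      fderiv ℂ (Cmap L U₀ S T j) (A' - H (Dt A')) (Pi.single bnd X) := by
    have h' := congrArg (fun Φ : (S → 𝔸) →L[ℂ] (T → 𝔸) => Φ (Pi.single bnd X)) h68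
    simpa using h'
  have hθ0 : 0 ≤ (C3Gen d L * (((L : ℝ) ^ j) ^ 2 * (2 * ε)) * (2 * d) * B₁ * Real.exp (2 * d * δ₀)) := by positivity
  have hM0 : 0 ≤ (1 - (C3Gen d L * (((L : ℝ) ^ j) ^ 2 * (2 * ε)) * (2 * d) * B₁ * Real.exp (2 * d * δ₀)) * (d * B6.c0 δ₀ (1 / 2) ^ d))⁻¹ * (Real.exp (d * δ₀) * (C3Gen d L * ((L : ℝ) ^ j) ^ 2 * (2 * ε) * (((L : ℝ) ^ j) ^ d)⁻¹) * ‖X‖) := mul_nonneg (inv_nonneg.2 (by linarith)) (by positivity)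
  -- the (73)-profile of the column `𝔇(X·e_b)`
  have h73 : ∀ c' : T, ‖fderiv ℂ Dt A' (Pi.single bnd X) c'‖ ≤ (1 - (C3Gen d L * (((L : ℝ) ^ j) ^ 2 * (2 * ε)) * (2 * d) * B₁ * Real.exp (2 * d * δ₀)) * (d * B6.c0 δ₀ (1 / 2) ^ d))⁻¹ * (Real.exp (d * δ₀) * (C3Gen d L * ((L : ℝ) ^ j) ^ 2 * (2 * ε) * (((L : ℝ) ^ j) ^ d)⁻¹) * ‖X‖) *
      (fun c' : T => Real.exp (-(1 / 2 * δ₀ * ((l1 (loK L j c'.1.1 - bnd.1.1) : ℝ) / (L : ℝ) ^ j)))) c' := fun c' =>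
    ineq73_kernel_of_eq68 L hL hG k U₀ hU₀ hα hα3 hα4 h52 hb hsmall hc₃ h145 h155 S T H hj hε0 (by linarith) hX₀ hδ₀ hB₁ hHker hq
      bnd X hv c'
  -- (T3): `ℜ𝔇` through the profile contraction (Lemma 2.1 [3])
  have hT3 : ‖fderiv ℂ (Cmap L U₀ S T j) (A' - H (Dt A')) (H (fderiv ℂ Dt A' (Pi.single bnd X))) c‖ ≤
      (C3Gen d L * (((L : ℝ) ^ j) ^ 2 * (2 * ε)) * (2 * d) * B₁ * Real.exp (2 * d * δ₀)) * (d * B6.c0 δ₀ (1 / 2) ^ d) * ((1 - (C3Gen d L * (((L : ℝ) ^ j) ^ 2 * (2 * ε)) * (2 * d) * B₁ * Real.exp (2 * d * δ₀)) * (d * B6.c0 δ₀ (1 / 2) ^ d))⁻¹ * (Real.exp (d * δ₀) * (C3Gen d L * ((L : ℝ) ^ j) ^ 2 * (2 * ε) * (((L : ℝ) ^ j) ^ d)⁻¹) * ‖X‖)) * (fun c' : T => Real.exp (-(1 / 2 * δ₀ * ((l1 (loK L j c'.1.1 - bnd.1.1) : ℝ) / (L : ℝ) ^ j)))) c :=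
    profile_contraction (ι := T) (F := 𝔸) (fun c' : T => c'.1.1) hθ0
      (R := fun w => fderiv ℂ (Cmap L U₀ S T j) (A' - H (Dt A')) (H w))
      (fun w i => ineq69_kernel L hL hG k U₀ hU₀ hα hα3 hα4 h52 hb hsmall hc₃ h145 h155 S T H hj hε0 (by linarith) hX₀ hδ₀.le hB₁
        hHker w i)
      (fun i => rowSum_T T hδ₀ i.1.1) (wt := (fun c' : T => Real.exp (-(1 / 2 * δ₀ * ((l1 (loK L j c'.1.1 - bnd.1.1) : ℝ) / (L : ℝ) ^ j))))) (fun i => (Real.exp_pos _).le)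
      (fun i i'' => by
        rw [← Real.exp_add]
        refine Real.exp_le_exp.2 ?_
        have ht := scaled_triangle hL1 j i.1.1 i''.1.1 bnd.1.1
        nlinarith)
      hM0 h73 c
  -- the entry `c` of `𝔇₂`: `𝔇(c) − D²f_c(0)(A′, h) = [Df_c(X₀)h − Df_c(A′)h] + [Df_c(A′)h − D²f_c(0)(A′, h)] − (ℜ𝔇)(c)`
  have hvc : fderiv ℂ Dt A' (Pi.single bnd X) c = fderiv ℂ (Cmap L U₀ S T j) (A' - H (Dt A')) (Pi.single bnd X) c -
      fderiv ℂ (Cmap L U₀ S T j) (A' - H (Dt A')) (H (fderiv ℂ Dt A' (Pi.single bnd X))) c := by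
    have h' := congrFun hv c
    simp only [Pi.add_apply] at h'
    rw [← h']
    abel
  have h2C : (2 : ℂ) • C2map L U₀ S T j A' (Pi.single bnd X) c = fderiv ℂ (fderiv ℂ (fun a' : S → 𝔸 => CCovIter L U₀ (insCfg S a') j c.1.1 c.1.2)) 0 A' (Pi.single bnd X) := by
    rw [C2map_apply, smul_smul, mul_inv_cancel₀ two_ne_zero, one_smul]
  have hsrc : fderiv ℂ (Cmap L U₀ S T j) (A' - H (Dt A')) (Pi.single bnd X) c = fderiv ℂ (fun a' : S → 𝔸 => CCovIter L U₀ (insCfg S a') j c.1.1 c.1.2) (A' - H (Dt A')) (Pi.single bnd X) :=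
    fderiv_Cmap_apply L hL hG k U₀ hU₀ hα hα3 hα4 h52 hb hsmall hc₃ S T hj hX₀s (Pi.single bnd X) c
  have hk : 0 ≤ kerQdd L j c.1.1 c.1.2 bnd.1.1 bnd.1.2 * ‖X‖ := mul_nonneg (kerQdd_nonneg L j _ _ _ _) (norm_nonneg _)
  -- (T1)
  have hT1 : ‖fderiv ℂ (fun a' : S → 𝔸 => CCovIter L U₀ (insCfg S a') j c.1.1 c.1.2) (A' - H (Dt A')) (Pi.single bnd X) - fderiv ℂ (fun a' : S → 𝔸 => CCovIter L U₀ (insCfg S a') j c.1.1 c.1.2) A' (Pi.single bnd X)‖ ≤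
      2 * (C3Gen d L * ((L : ℝ) ^ j) ^ 2) * (B₀ * (4 * ((8 * (131072 * ((d : ℝ) + 1) ^ 2) * Real.exp (4 * (800 * ((d : ℝ) + 1) ^ 2 * ((d : ℝ) + 4)) * α₀)) * ((L : ℝ) ^ j) ^ 2) * ε ^ 2)) * (kerQdd L j c.1.1 c.1.2 bnd.1.1 bnd.1.2 * ‖X‖) := by
    have h1 := norm_fderiv_sub_fderiv_le L hL hG k U₀ hU₀ hα hα3 hα4 h52 hb hsmall hc₃ h145 h155 S hj c.1.1 c.1.2
      (Y := A' - H (Dt A')) (Y' := A') (hX₀.trans (by linarith)) (hA.le.trans (by linarith)) (Pi.single bnd X)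
    rw [sum_kerQdd_single] at h1
    refine h1.trans ?_
    have hdiff : ‖A' - H (Dt A') - A'‖ ≤ B₀ * (4 * ((8 * (131072 * ((d : ℝ) + 1) ^ 2) * Real.exp (4 * (800 * ((d : ℝ) + 1) ^ 2 * ((d : ℝ) + 4)) * α₀)) * ((L : ℝ) ^ j) ^ 2) * ε ^ 2) := by
      rw [sub_sub_cancel_left, norm_neg]
      refine (hH (Dt A')).trans (mul_le_mul_of_nonneg_left ?_ hB₀)
      have hD := hDball A' hA
      rwa [mem_closedBall, dist_zero_right] at hD
    calc 2 * (C3Gen d L * ((L : ℝ) ^ j) ^ 2) * (kerQdd L j c.1.1 c.1.2 bnd.1.1 bnd.1.2 * ‖X‖) * ‖A' - H (Dt A') - A'‖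
        ≤ 2 * (C3Gen d L * ((L : ℝ) ^ j) ^ 2) * (kerQdd L j c.1.1 c.1.2 bnd.1.1 bnd.1.2 * ‖X‖) * (B₀ * (4 * ((8 * (131072 * ((d : ℝ) + 1) ^ 2) * Real.exp (4 * (800 * ((d : ℝ) + 1) ^ 2 * ((d : ℝ) + 4)) * α₀)) * ((L : ℝ) ^ j) ^ 2) * ε ^ 2)) := mul_le_mul_of_nonneg_left hdiff (by positivity)
      _ = 2 * (C3Gen d L * ((L : ℝ) ^ j) ^ 2) * (B₀ * (4 * ((8 * (131072 * ((d : ℝ) + 1) ^ 2) * Real.exp (4 * (800 * ((d : ℝ) + 1) ^ 2 * ((d : ℝ) + 4)) * α₀)) * ((L : ℝ) ^ j) ^ 2) * ε ^ 2)) * (kerQdd L j c.1.1 c.1.2 bnd.1.1 bnd.1.2 * ‖X‖) := by ring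
  -- (T2)
  have hT2 : ‖fderiv ℂ (fun a' : S → 𝔸 => CCovIter L U₀ (insCfg S a') j c.1.1 c.1.2) A' (Pi.single bnd X) - fderiv ℂ (fderiv ℂ (fun a' : S → 𝔸 => CCovIter L U₀ (insCfg S a') j c.1.1 c.1.2)) 0 A' (Pi.single bnd X)‖ ≤
      8 * (C3Gen d L * ((L : ℝ) ^ j) ^ 2) * b⁻¹ * ε ^ 2 * (kerQdd L j c.1.1 c.1.2 bnd.1.1 bnd.1.2 * ‖X‖) := by
    have h2 := norm_fderiv_sub_fderiv2_zero_le L hL hG k U₀ hU₀ hα hα3 hα4 h52 hb hsmall hc₃ h145 h155 S hj c.1.1 c.1.2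
      (A' := A') (by linarith) (Pi.single bnd X)
    rw [sum_kerQdd_single] at h2
    refine h2.trans ?_
    have hA2 : ‖A'‖ ^ 2 ≤ ε ^ 2 := pow_le_pow_left₀ (norm_nonneg _) hA.le 2
    have hb' : 0 ≤ 8 * (C3Gen d L * ((L : ℝ) ^ j) ^ 2) * b⁻¹ := by positivity
    exact mul_le_mul_of_nonneg_right (mul_le_mul_of_nonneg_left hA2 hb') hk
  -- assemble
  have hsplit : fderiv ℂ Dt A' (Pi.single bnd X) c - (2 : ℂ) • C2map L U₀ S T j A' (Pi.single bnd X) c =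
      (fderiv ℂ (fun a' : S → 𝔸 => CCovIter L U₀ (insCfg S a') j c.1.1 c.1.2) (A' - H (Dt A')) (Pi.single bnd X) - fderiv ℂ (fun a' : S → 𝔸 => CCovIter L U₀ (insCfg S a') j c.1.1 c.1.2) A' (Pi.single bnd X)) +
        (fderiv ℂ (fun a' : S → 𝔸 => CCovIter L U₀ (insCfg S a') j c.1.1 c.1.2) A' (Pi.single bnd X) - fderiv ℂ (fderiv ℂ (fun a' : S → 𝔸 => CCovIter L U₀ (insCfg S a') j c.1.1 c.1.2)) 0 A' (Pi.single bnd X)) -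
        fderiv ℂ (Cmap L U₀ S T j) (A' - H (Dt A')) (H (fderiv ℂ Dt A' (Pi.single bnd X))) c := by
    rw [hvc, h2C, hsrc]
    abel
  rw [hsplit]
  refine le_trans ((norm_sub_le _ _).trans (add_le_add (norm_add_le _ _) le_rfl)) ?_
  exact add_le_add (add_le_add hT1 hT2) hT3

include hL hG hU₀ hα hα3 hα4 h52 hb hsmall hc₃ h145 h155 in
/-- **«THE BOUND (73) WITH ε₃² INSTEAD OF ε₃» FOR `𝔇₂`, KERNEL LEVEL WITH DECAY, CONCRETE** (`q ≤ ½`, «for ε₃ sufficiently small»): for every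
`‖A′‖ < ε`, fine bond `b`, `X ∈ 𝔸`, coarse bond `c = (z, κ)`,
`‖(𝔇(A′)(X·e_b))(c) − 2C⁽²⁾(A′, X·e_b)(c)‖ ≤ K·ε²·L^{−jd}·e^{−½δ₀·l1(Lʲz − b₋)/Lʲ}·‖X‖`,
`K = 8e^{dδ₀}·C₃(Lʲ)²·(C₂(Lʲ)²B₀ + b⁻¹) + 16d·B₁·c₁·e^{3dδ₀}·(C₃(Lʲ)²)²` (`c₁ = d·c₀(δ₀, ½)ᵈ`) — compare (73) `≤ 4e^{dδ₀}·C₃(Lʲ)²·ε·L^{−jd}·e^{−½δ₀…}‖X‖`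
(`B11Eq73KernelConcrete.ineq73_concrete_two`): one more factor `ε`, the `O(1)` a `(d, L)`-constant. From `frakD2_kernel_concrete` with
`kerQdd(c, b) ≤ L^{−jd}e^{dδ₀}·wt_b(c)` (the box `Bʲ(c₋) ∪ Bʲ(c₊)` lies within `2dLʲ` of `c₋`, `B11Eq71KernelConcrete.l1_loK_sub_le_of_bondIn`) and
`(1 − q)⁻¹ ≤ 2`. [cite: Balaban1985Variational, p.289 (remark after Prop. 3), (73) p.289] [cite: Balaban1985Averaging, (141) p.39] -/
theorem frakD2_kernel_concrete_decay {j : ℕ} (hj : j ≤ k) (hB₀ : 0 ≤ B₀) (hH : ∀ X, ‖H X‖ ≤ B₀ * ‖X‖)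
    (hq9 : 9 * ((8 * (131072 * ((d : ℝ) + 1) ^ 2) * Real.exp (4 * (800 * ((d : ℝ) + 1) ^ 2 * ((d : ℝ) + 4)) * α₀))
      * ((L : ℝ) ^ j) ^ 2) * B₀ * ε < 1) (hε4 : 4 * ε ≤ b)
    (hDball : ∀ B : S → 𝔸, ‖B‖ < ε → Dt B ∈ closedBall (0 : T → 𝔸)
      (4 * ((8 * (131072 * ((d : ℝ) + 1) ^ 2) * Real.exp (4 * (800 * ((d : ℝ) + 1) ^ 2 * ((d : ℝ) + 4)) * α₀))
        * ((L : ℝ) ^ j) ^ 2) * ε ^ 2))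
    (hDfix : ∀ B : S → 𝔸, ‖B‖ < ε → Cmap L U₀ S T j (B - H (Dt B)) = Dt B)
    (hδ₀ : 0 < δ₀) (hB₁ : 0 ≤ B₁)
    (hHker : ∀ (c'' : T) (Y : 𝔸) (s : S),
      ‖H (Pi.single c'' Y) s‖ ≤ B₁ * Real.exp (-(δ₀ * ((l1 (loK L j c''.1.1 - s.1.1) : ℝ) / (L : ℝ) ^ j))) * ‖Y‖)
    (hq2 : (C3Gen d L * (((L : ℝ) ^ j) ^ 2 * (2 * ε)) * (2 * d) * B₁ * Real.exp (2 * d * δ₀)) * (d * B6.c0 δ₀ (1 / 2) ^ d) ≤ 1 / 2)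
    {A' : S → 𝔸} (hA : ‖A'‖ < ε) (bnd : S) (X : 𝔸) (c : T) :
    ‖fderiv ℂ Dt A' (Pi.single bnd X) c - (2 : ℂ) • C2map L U₀ S T j A' (Pi.single bnd X) c‖ ≤
      (8 * Real.exp (d * δ₀) * (C3Gen d L * ((L : ℝ) ^ j) ^ 2) * (((8 * (131072 * ((d : ℝ) + 1) ^ 2) * Real.exp (4 * (800 * ((d : ℝ) + 1) ^ 2 * ((d : ℝ) + 4)) * α₀)) * ((L : ℝ) ^ j) ^ 2) * B₀ + b⁻¹) +
        16 * d * B₁ * (d * B6.c0 δ₀ (1 / 2) ^ d) * Real.exp (3 * (d * δ₀)) * (C3Gen d L * ((L : ℝ) ^ j) ^ 2) ^ 2) *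
      ε ^ 2 * (((L : ℝ) ^ j) ^ d)⁻¹ * Real.exp (-(1 / 2 * δ₀ * ((l1 (loK L j c.1.1 - bnd.1.1) : ℝ) / (L : ℝ) ^ j))) * ‖X‖ := by
  have hε0 : 0 < ε := (norm_nonneg _).trans_lt hA
  have hC3 : 0 ≤ C3Gen d L := by unfold C3Gen C1ppGen; positivity
  have hLj : (0 : ℝ) < (L : ℝ) ^ j := by positivity
  have h := frakD2_kernel_concrete L hL hG k U₀ hU₀ hα hα3 hα4 h52 hb hsmall hc₃ h145 h155 S T H hj hB₀ hH hq9 hε4 hDball hDfix hδ₀ hB₁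
    hHker (by linarith) hA bnd X c
  refine h.trans ?_
  have hC₂'0 : 0 ≤ ((8 * (131072 * ((d : ℝ) + 1) ^ 2) * Real.exp (4 * (800 * ((d : ℝ) + 1) ^ 2 * ((d : ℝ) + 4)) * α₀)) * ((L : ℝ) ^ j) ^ 2) := by positivity
  have hC₃'0 : 0 ≤ (C3Gen d L * ((L : ℝ) ^ j) ^ 2) := by positivity
  have hθ0 : 0 ≤ (C3Gen d L * (((L : ℝ) ^ j) ^ 2 * (2 * ε)) * (2 * d) * B₁ * Real.exp (2 * d * δ₀)) := by positivity
  have hc₁0 : 0 ≤ (d * B6.c0 δ₀ (1 / 2) ^ d) := by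
    have h0 : 0 ≤ B6.c0 δ₀ (1 / 2) := by
      unfold B6.c0
      exact tsum_nonneg fun _ => (Real.exp_pos _).le
    positivity
  have hwt0 : 0 < Real.exp (-(1 / 2 * δ₀ * ((l1 (loK L j c.1.1 - bnd.1.1) : ℝ) / (L : ℝ) ^ j))) := Real.exp_pos _
  have hE0 : 0 ≤ (Real.exp (d * δ₀) * (C3Gen d L * ((L : ℝ) ^ j) ^ 2 * (2 * ε) * (((L : ℝ) ^ j) ^ d)⁻¹) * ‖X‖) := by positivity
  -- (i) the two local terms: `kerQdd(c, b) ≤ L^{−jd}e^{dδ₀}·wt_b(c)`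
  have hker : kerQdd L j c.1.1 c.1.2 bnd.1.1 bnd.1.2 * ‖X‖ ≤ (((L : ℝ) ^ j) ^ d)⁻¹ * Real.exp (d * δ₀) * Real.exp (-(1 / 2 * δ₀ * ((l1 (loK L j c.1.1 - bnd.1.1) : ℝ) / (L : ℝ) ^ j))) * ‖X‖ := by
    by_cases hin : BondIn (loK L j c.1.1) (bondHiK L j c.1.1 c.1.2) bnd.1.1 bnd.1.2
    · rw [kerQdd_of_bondIn hin]
      refine mul_le_mul_of_nonneg_right ?_ (norm_nonneg _)
      have hbox := l1_loK_sub_le_of_bondIn hin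
      have hwt1 : Real.exp (-(d * δ₀)) ≤ Real.exp (-(1 / 2 * δ₀ * ((l1 (loK L j c.1.1 - bnd.1.1) : ℝ) / (L : ℝ) ^ j))) := by
        refine Real.exp_le_exp.2 ?_
        have h2d : (l1 (loK L j c.1.1 - bnd.1.1) : ℝ) / (L : ℝ) ^ j ≤ 2 * d := by rw [div_le_iff₀ hLj]; exact hbox
        nlinarith
      have hone : Real.exp (d * δ₀) * Real.exp (-(d * δ₀)) = 1 := by
        rw [← Real.exp_add, add_neg_cancel, Real.exp_zero]
      calc (((L : ℝ) ^ j) ^ d)⁻¹ = (((L : ℝ) ^ j) ^ d)⁻¹ * (Real.exp (d * δ₀) * Real.exp (-(d * δ₀))) := by rw [hone, mul_one]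
        _ = (((L : ℝ) ^ j) ^ d)⁻¹ * Real.exp (d * δ₀) * Real.exp (-(d * δ₀)) := by ring
        _ ≤ (((L : ℝ) ^ j) ^ d)⁻¹ * Real.exp (d * δ₀) * Real.exp (-(1 / 2 * δ₀ * ((l1 (loK L j c.1.1 - bnd.1.1) : ℝ) / (L : ℝ) ^ j))) := mul_le_mul_of_nonneg_left hwt1 (by positivity)
    · rw [kerQdd_of_not_bondIn hin, zero_mul]
      positivity
  have h1 : 2 * (C3Gen d L * ((L : ℝ) ^ j) ^ 2) * (B₀ * (4 * ((8 * (131072 * ((d : ℝ) + 1) ^ 2) * Real.exp (4 * (800 * ((d : ℝ) + 1) ^ 2 * ((d : ℝ) + 4)) * α₀)) * ((L : ℝ) ^ j) ^ 2) * ε ^ 2)) * (kerQdd L j c.1.1 c.1.2 bnd.1.1 bnd.1.2 * ‖X‖) + 8 * (C3Gen d L * ((L : ℝ) ^ j) ^ 2) * b⁻¹ * ε ^ 2 * (kerQdd L j c.1.1 c.1.2 bnd.1.1 bnd.1.2 * ‖X‖) ≤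
      8 * Real.exp (d * δ₀) * (C3Gen d L * ((L : ℝ) ^ j) ^ 2) * (((8 * (131072 * ((d : ℝ) + 1) ^ 2) * Real.exp (4 * (800 * ((d : ℝ) + 1) ^ 2 * ((d : ℝ) + 4)) * α₀)) * ((L : ℝ) ^ j) ^ 2) * B₀ + b⁻¹) * ε ^ 2 * (((L : ℝ) ^ j) ^ d)⁻¹ * Real.exp (-(1 / 2 * δ₀ * ((l1 (loK L j c.1.1 - bnd.1.1) : ℝ) / (L : ℝ) ^ j))) * ‖X‖ := by
    have hcoef : 0 ≤ 2 * (C3Gen d L * ((L : ℝ) ^ j) ^ 2) * (B₀ * (4 * ((8 * (131072 * ((d : ℝ) + 1) ^ 2) * Real.exp (4 * (800 * ((d : ℝ) + 1) ^ 2 * ((d : ℝ) + 4)) * α₀)) * ((L : ℝ) ^ j) ^ 2) * ε ^ 2)) + 8 * (C3Gen d L * ((L : ℝ) ^ j) ^ 2) * b⁻¹ * ε ^ 2 := by positivity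
    have hh := mul_le_mul_of_nonneg_left hker hcoef
    calc 2 * (C3Gen d L * ((L : ℝ) ^ j) ^ 2) * (B₀ * (4 * ((8 * (131072 * ((d : ℝ) + 1) ^ 2) * Real.exp (4 * (800 * ((d : ℝ) + 1) ^ 2 * ((d : ℝ) + 4)) * α₀)) * ((L : ℝ) ^ j) ^ 2) * ε ^ 2)) * (kerQdd L j c.1.1 c.1.2 bnd.1.1 bnd.1.2 * ‖X‖) + 8 * (C3Gen d L * ((L : ℝ) ^ j) ^ 2) * b⁻¹ * ε ^ 2 * (kerQdd L j c.1.1 c.1.2 bnd.1.1 bnd.1.2 * ‖X‖)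
        = (2 * (C3Gen d L * ((L : ℝ) ^ j) ^ 2) * (B₀ * (4 * ((8 * (131072 * ((d : ℝ) + 1) ^ 2) * Real.exp (4 * (800 * ((d : ℝ) + 1) ^ 2 * ((d : ℝ) + 4)) * α₀)) * ((L : ℝ) ^ j) ^ 2) * ε ^ 2)) + 8 * (C3Gen d L * ((L : ℝ) ^ j) ^ 2) * b⁻¹ * ε ^ 2) * (kerQdd L j c.1.1 c.1.2 bnd.1.1 bnd.1.2 * ‖X‖) := by ring
      _ ≤ (2 * (C3Gen d L * ((L : ℝ) ^ j) ^ 2) * (B₀ * (4 * ((8 * (131072 * ((d : ℝ) + 1) ^ 2) * Real.exp (4 * (800 * ((d : ℝ) + 1) ^ 2 * ((d : ℝ) + 4)) * α₀)) * ((L : ℝ) ^ j) ^ 2) * ε ^ 2)) + 8 * (C3Gen d L * ((L : ℝ) ^ j) ^ 2) * b⁻¹ * ε ^ 2) *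
          ((((L : ℝ) ^ j) ^ d)⁻¹ * Real.exp (d * δ₀) * Real.exp (-(1 / 2 * δ₀ * ((l1 (loK L j c.1.1 - bnd.1.1) : ℝ) / (L : ℝ) ^ j))) * ‖X‖) := hh
      _ = _ := by ring
  -- (ii) the `ℜ𝔇` term: `(1 − q)⁻¹ ≤ 2`, `e^{2dδ₀}e^{dδ₀} = e^{3dδ₀}`
  have hinv : (1 - (C3Gen d L * (((L : ℝ) ^ j) ^ 2 * (2 * ε)) * (2 * d) * B₁ * Real.exp (2 * d * δ₀)) * (d * B6.c0 δ₀ (1 / 2) ^ d))⁻¹ ≤ 2 := by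
    rw [inv_le_comm₀ (by linarith) two_pos]
    linarith
  have hexp : Real.exp (2 * d * δ₀) * Real.exp (d * δ₀) = Real.exp (3 * (d * δ₀)) := by
    rw [← Real.exp_add]; ring_nf
  have h2 : (C3Gen d L * (((L : ℝ) ^ j) ^ 2 * (2 * ε)) * (2 * d) * B₁ * Real.exp (2 * d * δ₀)) * (d * B6.c0 δ₀ (1 / 2) ^ d) * ((1 - (C3Gen d L * (((L : ℝ) ^ j) ^ 2 * (2 * ε)) * (2 * d) * B₁ * Real.exp (2 * d * δ₀)) * (d * B6.c0 δ₀ (1 / 2) ^ d))⁻¹ * (Real.exp (d * δ₀) * (C3Gen d L * ((L : ℝ) ^ j) ^ 2 * (2 * ε) * (((L : ℝ) ^ j) ^ d)⁻¹) * ‖X‖)) * Real.exp (-(1 / 2 * δ₀ * ((l1 (loK L j c.1.1 - bnd.1.1) : ℝ) / (L : ℝ) ^ j))) ≤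
      16 * d * B₁ * (d * B6.c0 δ₀ (1 / 2) ^ d) * Real.exp (3 * (d * δ₀)) * (C3Gen d L * ((L : ℝ) ^ j) ^ 2) ^ 2 * ε ^ 2 * (((L : ℝ) ^ j) ^ d)⁻¹ * Real.exp (-(1 / 2 * δ₀ * ((l1 (loK L j c.1.1 - bnd.1.1) : ℝ) / (L : ℝ) ^ j))) * ‖X‖ := by
    have hθc : 0 ≤ (C3Gen d L * (((L : ℝ) ^ j) ^ 2 * (2 * ε)) * (2 * d) * B₁ * Real.exp (2 * d * δ₀)) * (d * B6.c0 δ₀ (1 / 2) ^ d) := mul_nonneg hθ0 hc₁0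
    calc (C3Gen d L * (((L : ℝ) ^ j) ^ 2 * (2 * ε)) * (2 * d) * B₁ * Real.exp (2 * d * δ₀)) * (d * B6.c0 δ₀ (1 / 2) ^ d) * ((1 - (C3Gen d L * (((L : ℝ) ^ j) ^ 2 * (2 * ε)) * (2 * d) * B₁ * Real.exp (2 * d * δ₀)) * (d * B6.c0 δ₀ (1 / 2) ^ d))⁻¹ * (Real.exp (d * δ₀) * (C3Gen d L * ((L : ℝ) ^ j) ^ 2 * (2 * ε) * (((L : ℝ) ^ j) ^ d)⁻¹) * ‖X‖)) * Real.exp (-(1 / 2 * δ₀ * ((l1 (loK L j c.1.1 - bnd.1.1) : ℝ) / (L : ℝ) ^ j)))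
        ≤ (C3Gen d L * (((L : ℝ) ^ j) ^ 2 * (2 * ε)) * (2 * d) * B₁ * Real.exp (2 * d * δ₀)) * (d * B6.c0 δ₀ (1 / 2) ^ d) * (2 * (Real.exp (d * δ₀) * (C3Gen d L * ((L : ℝ) ^ j) ^ 2 * (2 * ε) * (((L : ℝ) ^ j) ^ d)⁻¹) * ‖X‖)) * Real.exp (-(1 / 2 * δ₀ * ((l1 (loK L j c.1.1 - bnd.1.1) : ℝ) / (L : ℝ) ^ j))) := by
          refine mul_le_mul_of_nonneg_right (mul_le_mul_of_nonneg_left ?_ hθc) hwt0.le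
          exact mul_le_mul_of_nonneg_right hinv hE0
      _ = 16 * d * B₁ * (d * B6.c0 δ₀ (1 / 2) ^ d) * (Real.exp (2 * d * δ₀) * Real.exp (d * δ₀)) * (C3Gen d L * ((L : ℝ) ^ j) ^ 2) ^ 2 * ε ^ 2 * (((L : ℝ) ^ j) ^ d)⁻¹ *
            Real.exp (-(1 / 2 * δ₀ * ((l1 (loK L j c.1.1 - bnd.1.1) : ℝ) / (L : ℝ) ^ j))) * ‖X‖ := by ring
      _ = 16 * d * B₁ * (d * B6.c0 δ₀ (1 / 2) ^ d) * Real.exp (3 * (d * δ₀)) * (C3Gen d L * ((L : ℝ) ^ j) ^ 2) ^ 2 * ε ^ 2 * (((L : ℝ) ^ j) ^ d)⁻¹ * Real.exp (-(1 / 2 * δ₀ * ((l1 (loK L j c.1.1 - bnd.1.1) : ℝ) / (L : ℝ) ^ j))) * ‖X‖ := by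
          rw [hexp]
  have hsum : (8 * Real.exp (d * δ₀) * (C3Gen d L * ((L : ℝ) ^ j) ^ 2) * (((8 * (131072 * ((d : ℝ) + 1) ^ 2) * Real.exp (4 * (800 * ((d : ℝ) + 1) ^ 2 * ((d : ℝ) + 4)) * α₀)) * ((L : ℝ) ^ j) ^ 2) * B₀ + b⁻¹) +
        16 * d * B₁ * (d * B6.c0 δ₀ (1 / 2) ^ d) * Real.exp (3 * (d * δ₀)) * (C3Gen d L * ((L : ℝ) ^ j) ^ 2) ^ 2) *
      ε ^ 2 * (((L : ℝ) ^ j) ^ d)⁻¹ * Real.exp (-(1 / 2 * δ₀ * ((l1 (loK L j c.1.1 - bnd.1.1) : ℝ) / (L : ℝ) ^ j))) * ‖X‖ =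
      8 * Real.exp (d * δ₀) * (C3Gen d L * ((L : ℝ) ^ j) ^ 2) * (((8 * (131072 * ((d : ℝ) + 1) ^ 2) * Real.exp (4 * (800 * ((d : ℝ) + 1) ^ 2 * ((d : ℝ) + 4)) * α₀)) * ((L : ℝ) ^ j) ^ 2) * B₀ + b⁻¹) * ε ^ 2 * (((L : ℝ) ^ j) ^ d)⁻¹ * Real.exp (-(1 / 2 * δ₀ * ((l1 (loK L j c.1.1 - bnd.1.1) : ℝ) / (L : ℝ) ^ j))) * ‖X‖ +
        16 * d * B₁ * (d * B6.c0 δ₀ (1 / 2) ^ d) * Real.exp (3 * (d * δ₀)) * (C3Gen d L * ((L : ℝ) ^ j) ^ 2) ^ 2 * ε ^ 2 * (((L : ℝ) ^ j) ^ d)⁻¹ * Real.exp (-(1 / 2 * δ₀ * ((l1 (loK L j c.1.1 - bnd.1.1) : ℝ) / (L : ℝ) ^ j))) * ‖X‖ := by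
    ring
  rw [hsum]
  exact add_le_add h1 h2

/-! ## §3 (v1.1) The remark for r08's selector `Dfix` -/

include hL hG hU₀ hα hα3 hα4 h52 hb hsmall hc₃ h145 h155 in
/-- **«THE BOUND (73) WITH ε₃² INSTEAD OF ε₃» FOR THE `𝔇₂` OF r08's SELECTOR `D(A′) = Dfix (C_j(U₀, ·)) H (C₂(Lʲ)²)`** (`B11Prop3Model.Dfix`, the
solution of (49) in the (55)-ball; = every `D̃` with that characterization): for `q ≤ ½`, `4ε ≤ b`, every `‖A′‖ < ε`, fine bond `b`, `X ∈ 𝔸`,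
coarse bond `c = (z, κ)`: `‖((δ/δA′)D(A′))(X·e_b)(c) − 2C⁽²⁾(A′, X·e_b)(c)‖ ≤ K·ε²·L^{−jd}·e^{−½δ₀·l1(Lʲz − b₋)/Lʲ}·‖X‖` with the `K` of
`frakD2_kernel_concrete_decay` (its hypotheses `hDball`/`hDfix` being `Dfix_ball`/`Dfix_fix` at `B11Eq44Concrete.quadAnalytic_Cmap`).
[cite: Balaban1985Variational, p.289 (remark after Prop. 3), (73) p.289, (49) p.285, (55) p.286] -/
theorem frakD2_Dfix_decay {j : ℕ} (hj : j ≤ k) (hB₀ : 0 ≤ B₀) (hH : ∀ X, ‖H X‖ ≤ B₀ * ‖X‖)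
    (hq9 : 9 * ((8 * (131072 * ((d : ℝ) + 1) ^ 2) * Real.exp (4 * (800 * ((d : ℝ) + 1) ^ 2 * ((d : ℝ) + 4)) * α₀))
      * ((L : ℝ) ^ j) ^ 2) * B₀ * ε < 1) (hε4 : 4 * ε ≤ b)
    (hδ₀ : 0 < δ₀) (hB₁ : 0 ≤ B₁)
    (hHker : ∀ (c'' : T) (Y : 𝔸) (s : S),
      ‖H (Pi.single c'' Y) s‖ ≤ B₁ * Real.exp (-(δ₀ * ((l1 (loK L j c''.1.1 - s.1.1) : ℝ) / (L : ℝ) ^ j))) * ‖Y‖)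
    (hq2 : (C3Gen d L * (((L : ℝ) ^ j) ^ 2 * (2 * ε)) * (2 * d) * B₁ * Real.exp (2 * d * δ₀)) * (d * B6.c0 δ₀ (1 / 2) ^ d) ≤ 1 / 2)
    {A' : S → 𝔸} (hA : ‖A'‖ < ε) (bnd : S) (X : 𝔸) (c : T) :
    ‖fderiv ℂ (Dfix (Cmap L U₀ S T j) (H : (T → 𝔸) →ₗ[ℂ] (S → 𝔸)) ((8 * (131072 * ((d : ℝ) + 1) ^ 2) * Real.exp (4 * (800 * ((d : ℝ) + 1) ^ 2 * ((d : ℝ) + 4)) * α₀)) * ((L : ℝ) ^ j) ^ 2)) A' (Pi.single bnd X) c -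
        (2 : ℂ) • C2map L U₀ S T j A' (Pi.single bnd X) c‖ ≤
      (8 * Real.exp (d * δ₀) * (C3Gen d L * ((L : ℝ) ^ j) ^ 2) * (((8 * (131072 * ((d : ℝ) + 1) ^ 2) * Real.exp (4 * (800 * ((d : ℝ) + 1) ^ 2 * ((d : ℝ) + 4)) * α₀)) * ((L : ℝ) ^ j) ^ 2) * B₀ + b⁻¹) +
        16 * d * B₁ * (d * B6.c0 δ₀ (1 / 2) ^ d) * Real.exp (3 * (d * δ₀)) * (C3Gen d L * ((L : ℝ) ^ j) ^ 2) ^ 2) *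
      ε ^ 2 * (((L : ℝ) ^ j) ^ d)⁻¹ * Real.exp (-(1 / 2 * δ₀ * ((l1 (loK L j c.1.1 - bnd.1.1) : ℝ) / (L : ℝ) ^ j))) * ‖X‖ := by
  have hε0 : 0 < ε := (norm_nonneg _).trans_lt hA
  have hε3 : 3 * ε ≤ b := by linarith
  have hK : (0 : ℝ) ≤ ((8 * (131072 * ((d : ℝ) + 1) ^ 2) * Real.exp (4 * (800 * ((d : ℝ) + 1) ^ 2 * ((d : ℝ) + 4)) * α₀)) * ((L : ℝ) ^ j) ^ 2) := by positivity
  have hQ := quadAnalytic_Cmap L hL hG k U₀ hU₀ hα hα3 hα4 h52 hb hsmall hc₃ S T hj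
  have hH' : ∀ X, ‖(H : (T → 𝔸) →ₗ[ℂ] (S → 𝔸)) X‖ ≤ B₀ * ‖X‖ := fun X => by simpa using hH X
  exact frakD2_kernel_concrete_decay L hL hG k U₀ hU₀ hα hα3 hα4 h52 hb hsmall hc₃ h145 h155 S T H hj hB₀ hH hq9 hε4
    (Dt := Dfix (Cmap L U₀ S T j) (H : (T → 𝔸) →ₗ[ℂ] (S → 𝔸)) ((8 * (131072 * ((d : ℝ) + 1) ^ 2) * Real.exp (4 * (800 * ((d : ℝ) + 1) ^ 2 * ((d : ℝ) + 4)) * α₀)) * ((L : ℝ) ^ j) ^ 2))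
    (fun B hB => by simpa using Dfix_ball hQ hK hB₀ hH' hq9 hε3 B hB)
    (fun B hB => by simpa using Dfix_fix hQ hK hB₀ hH' hq9 hε3 B hB) hδ₀ hB₁ hHker hq2 hA bnd X c

end Regime

end Literature.MathematicalPhysics.QuantumFieldTheory.Balaban1983to89.B11Rem289KernelConcrete

end
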